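import Mathlib
import Summits.KontsevichZagierPeriods.Zeta5Search.SorokinCensus.GeneralizedSigma
import HarnessLib

/-!
HONEST FRAMING: systematic search; no irrationality claim unless certified.

# The generalized Sorokin family `J₅^gen` — Moves (FAMILY.md §17; = Fischler's `𝒥(p)`, C. R. Math. 335 (2002) §3)

This module: binomial moves inside the generalized family (`GenExpansionMove` PROVED), from the generalized cone to the generalized locus, and the CONDITIONAL balanced decomposition `balancedDecompositionIntegrable_of : EulerInvariance → ReversalInvariance → BalancedDecompositionIntegrable`.

fam-sorokin gen 4 (planner-pub-zeta5-fam-sorokin-g4-0), staged `SorokinGeneralized.lean` v9 (sha256 e6bbed22…, 1570 l., filing request #2 FINAL-6 = last); split by the cell filing lane (lead/lit g11) at the gate's 400-line cap into `Generalized` (defs + statement nodes) → `GeneralizedSigma` → `GeneralizedMoves` → `GeneralizedEuler` → `GeneralizedReversalCoords` → `GeneralizedReversal` (linear import chain; mathematics verbatim, one-line docstrings added where missing, a private cube-measurability lemma duplicated across the split).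
Nothing here is an irrationality statement: elementary identities / calculus of absolutely convergent 5-fold integrals and integer bookkeeping.
-/

namespace Summit.KontsevichZagierPeriods.Zeta5Search.SorokinCensus

open Literature.NumberTheory.Irrationality.Zudilin2002 MeasureTheory Finset Set
open GenPoint

/-- The cube `[0,1]^5` is measurable (private copy for this module of the split; specialised statement — a same-shape general lemma for a different `cube` exists elsewhere in the tree). -/
private theorem measurableSet_cube5M : MeasurableSet (cube 5) :=
  MeasurableSet.univ_pi fun _ => measurableSet_Icc

/-! ## Binomial moves inside the generalized family (FAMILY 17d step (2); proved)

Inserting `(x_j + (1 - x_j))^N = 1` expands `J(p)` positively over the points `p.shift j i N`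
(`a_j ↦ a_j + i`, `b_j ↦ b_j + N`), at FIXED `a₀` and `e` — the generalized-family version of `ExpansionMove`. -/

namespace GenPoint

/-- The shifted point of a binomial move at coordinate `j`: `a_j += i`, `b_j += N` (so `c_j += N - i`). -/
def shift (p : GenPoint) (j : Fin 5) (i N : ℕ) : GenPoint :=
  { p with a := Function.update p.a j (p.a j + i), b := Function.update p.b j (p.b j + N) }

/-- `shift_a₀`: `(p : GenPoint) (j : Fin 5) (i N : ℕ) : (p.shift j i N).a₀ = p.a₀`. -/
@[simp] theorem shift_a₀ (p : GenPoint) (j : Fin 5) (i N : ℕ) : (p.shift j i N).a₀ = p.a₀ := rfl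
/-- `shift_e` (simp lemma). -/
@[simp] theorem shift_e (p : GenPoint) (j : Fin 5) (i N : ℕ) : (p.shift j i N).e = p.e := rfl
/-- `shift_a` (auxiliary lemma). -/
theorem shift_a (p : GenPoint) (j : Fin 5) (i N : ℕ) :
    (p.shift j i N).a = Function.update p.a j (p.a j + i) := rfl
/-- `shift_b`: `(p : GenPoint) (j : Fin 5) (i N : ℕ) : (p.shift j i N).b = Function.update p.b j (p.b j + N)`. -/
theorem shift_b (p : GenPoint) (j : Fin 5) (i N : ℕ) :
    (p.shift j i N).b = Function.update p.b j (p.b j + N) := rfl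

/-- Integer-exponent splitting of the shifted factor (valid for every real `x`). -/
theorem gfactor_split (x : ℝ) (a c : ℤ) (i N : ℕ) (ha : 1 ≤ a) (hc : 1 ≤ c) (hi : i ≤ N) :
    x ^ (a + i - 1) * (1 - x) ^ (c + N - i - 1)
      = (x ^ i * (1 - x) ^ (N - i)) * (x ^ (a - 1) * (1 - x) ^ (c - 1)) := by
  obtain ⟨m, hm⟩ := Int.eq_ofNat_of_zero_le (show (0 : ℤ) ≤ a - 1 by omega)
  obtain ⟨n, hn⟩ := Int.eq_ofNat_of_zero_le (show (0 : ℤ) ≤ c - 1 by omega)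
  have e1 : (a + i - 1 : ℤ) = ((m + i : ℕ) : ℤ) := by push_cast; omega
  have e2 : (c + N - i - 1 : ℤ) = ((n + (N - i) : ℕ) : ℤ) := by push_cast [Nat.cast_sub hi]; omega
  rw [e1, e2, hm, hn, zpow_natCast, zpow_natCast, zpow_natCast, zpow_natCast, pow_add, pow_add]
  ring

/-- Pointwise (every `x`): the integrand of the shifted point is the binomial weight times the original. -/
theorem integrand_shift (p : GenPoint) (j : Fin 5) (i N : ℕ) (ha : p.Admissible) (hi : i ≤ N)
    (x : Fin 5 → ℝ) :
    (p.shift j i N).integrand x = (x j ^ i * (1 - x j) ^ (N - i)) * p.integrand x := by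
  have hfac : ∀ k : Fin 5,
      x k ^ ((p.shift j i N).a k - 1) * (1 - x k) ^ ((p.shift j i N).c k - 1)
        = (if k = j then x k ^ i * (1 - x k) ^ (N - i) else 1) * (x k ^ (p.a k - 1) * (1 - x k) ^ (p.c k - 1)) := by
    intro k
    by_cases h : k = j
    · subst h
      simp only [GenPoint.c, shift_a, shift_b, Function.update_self, if_true]
      have := gfactor_split (x k) (p.a k) (p.c k) i N (ha k).1 (by have := (ha k).2; simp only [GenPoint.c]; omega) hi
      simp only [GenPoint.c] at this
      convert this using 3; ring
    · simp only [GenPoint.c, shift_a, shift_b, Function.update_of_ne h, h, if_false, one_mul]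
  have hprod := Finset.prod_congr (rfl : (Finset.univ : Finset (Fin 5)) = Finset.univ)
    (fun k (_ : k ∈ Finset.univ) => hfac k)
  have hc : (∏ k : Fin 5, (if k = j then x k ^ i * (1 - x k) ^ (N - i) else 1) *
        (x k ^ (p.a k - 1) * (1 - x k) ^ (p.c k - 1)))
      = (x j ^ i * (1 - x j) ^ (N - i)) * ∏ k : Fin 5, (x k ^ (p.a k - 1) * (1 - x k) ^ (p.c k - 1)) := by
    rw [Finset.prod_mul_distrib, Finset.prod_ite_eq' Finset.univ j, if_pos (Finset.mem_univ j)]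
  simp only [GenPoint.integrand, shift_a₀, shift_e]
  rw [hprod.trans hc]
  ring

/-- The binomial weight times an integrable integrand is integrable on the cube. -/
theorem integrable_weight_mul (p : GenPoint) (j : Fin 5) (i N : ℕ) (hint : p.Integrable) :
    MeasureTheory.Integrable (fun x : Fin 5 → ℝ => (x j ^ i * (1 - x j) ^ (N - i)) * p.integrand x)
      (volume.restrict (cube 5)) := by
  have hφc : Continuous fun x : Fin 5 → ℝ => x j ^ i * (1 - x j) ^ (N - i) := by fun_prop
  have hfI : MeasureTheory.Integrable p.integrand (volume.restrict (cube 5)) := hint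
  refine hfI.mono (hφc.aestronglyMeasurable.mul hfI.aestronglyMeasurable) ?_
  refine ae_restrict_of_forall_mem measurableSet_cube5M ?_
  intro x hx
  have h0 : 0 ≤ x j := ((Set.mem_univ_pi.mp hx) j).1
  have h1 : x j ≤ 1 := ((Set.mem_univ_pi.mp hx) j).2
  have hφ0 : 0 ≤ x j ^ i * (1 - x j) ^ (N - i) := mul_nonneg (pow_nonneg h0 _) (pow_nonneg (by linarith) _)
  have hφ1 : x j ^ i * (1 - x j) ^ (N - i) ≤ 1 :=
    mul_le_one₀ (pow_le_one₀ h0 h1) (pow_nonneg (by linarith) _) (pow_le_one₀ (by linarith) (by linarith))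
  rw [norm_mul, Real.norm_eq_abs, abs_of_nonneg hφ0]
  exact mul_le_of_le_one_left (norm_nonneg _) hφ1

/-- Shifted points stay admissible and integrable. -/
theorem shift_admissible (p : GenPoint) (j : Fin 5) (i N : ℕ) (ha : p.Admissible) (hi : i ≤ N) :
    (p.shift j i N).Admissible := by
  intro k
  by_cases h : k = j
  · subst h; simp only [shift_a, shift_b, Function.update_self]; have := ha k; omega
  · simp only [shift_a, shift_b, Function.update_of_ne h]; exact ha k

/-- `shift_integrable`: `(p : GenPoint) (j : Fin 5) (i N : ℕ) (ha : p.Admissible) (hi : i ≤ N) (hint : p.Integrable) : (p.shift j i …`. -/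
theorem shift_integrable (p : GenPoint) (j : Fin 5) (i N : ℕ) (ha : p.Admissible) (hi : i ≤ N)
    (hint : p.Integrable) : (p.shift j i N).Integrable :=
  (integrable_weight_mul p j i N hint).congr (ae_of_all _ fun x => (integrand_shift p j i N ha hi x).symm)

/-- THE GENERALIZED BINOMIAL MOVE (proved): `J(p) = Σ_{i ≤ N} C(N,i) · J(p.shift j i N)`. -/
theorem J_expansion (p : GenPoint) (j : Fin 5) (N : ℕ) (ha : p.Admissible) (hint : p.Integrable) :
    p.J = ∑ i ∈ range (N + 1), (N.choose i : ℝ) * (p.shift j i N).J := by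
  have hsum : ∀ x : Fin 5 → ℝ,
      ∑ i ∈ range (N + 1), (N.choose i : ℝ) * ((x j ^ i * (1 - x j) ^ (N - i)) * p.integrand x)
        = p.integrand x := by
    intro x
    have h1 : ∑ i ∈ range (N + 1), x j ^ i * (1 - x j) ^ (N - i) * (N.choose i : ℝ) = 1 := by
      rw [← add_pow]; simp
    calc ∑ i ∈ range (N + 1), (N.choose i : ℝ) * ((x j ^ i * (1 - x j) ^ (N - i)) * p.integrand x)
        = (∑ i ∈ range (N + 1), x j ^ i * (1 - x j) ^ (N - i) * (N.choose i : ℝ)) * p.integrand x := by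
          rw [Finset.sum_mul]; exact Finset.sum_congr rfl fun i _ => by ring
      _ = p.integrand x := by rw [h1, one_mul]
  have hInt : ∀ i ∈ range (N + 1), MeasureTheory.Integrable
      (fun x => (N.choose i : ℝ) * ((x j ^ i * (1 - x j) ^ (N - i)) * p.integrand x))
      (volume.restrict (cube 5)) :=
    fun i _ => (integrable_weight_mul p j i N hint).const_mul _
  unfold GenPoint.J
  symm
  calc ∑ i ∈ range (N + 1), (N.choose i : ℝ) * ∫ x in cube 5, (p.shift j i N).integrand x
      = ∑ i ∈ range (N + 1), (N.choose i : ℝ) * ∫ x in cube 5, (x j ^ i * (1 - x j) ^ (N - i)) * p.integrand x := by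
        refine Finset.sum_congr rfl fun i hi => ?_
        have hiN : i ≤ N := Nat.lt_succ_iff.mp (Finset.mem_range.mp hi)
        rw [setIntegral_congr_fun measurableSet_cube5M (fun x _ => integrand_shift p j i N ha hiN x)]
    _ = ∑ i ∈ range (N + 1), ∫ x in cube 5, (N.choose i : ℝ) * ((x j ^ i * (1 - x j) ^ (N - i)) * p.integrand x) :=
        Finset.sum_congr rfl fun i _ => (integral_const_mul _ _).symm
    _ = ∫ x in cube 5, ∑ i ∈ range (N + 1), (N.choose i : ℝ) * ((x j ^ i * (1 - x j) ^ (N - i)) * p.integrand x) :=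
        (integral_finsetSum _ hInt).symm
    _ = ∫ x in cube 5, p.integrand x := setIntegral_congr_fun measurableSet_cube5M (fun x _ => hsum x)

/-- The move changes the defect chain by `T_j ↦ T_j + N` (via `b_j`) and `T_{j-1} ↦ T_{j-1} + i` (via `a_j`), keeps
`a₀`, `e`, hence stays inside `{e fixed}`; recorded here for coordinate `j = 3` as used in 17d. -/
theorem shift_T_three (p : GenPoint) (i N : ℕ) :
    (p.shift 3 i N).T = ![p.T 0, p.T 1, p.T 2 + i, p.T 3 + N] := by
  funext k
  fin_cases k <;> simp [T, shift_a, shift_b] <;> ring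

end GenPoint

/-- GENERALIZED EXPANSION MOVE (statement node; PROVED below as `genExpansionMove_holds`). -/
@[conjecture] def GenExpansionMove : Prop :=
  ∀ (p : GenPoint) (j : Fin 5) (N : ℕ), p.Admissible → p.Integrable →
    p.J = ∑ i ∈ range (N + 1), (N.choose i : ℝ) * (p.shift j i N).J

/-- `genExpansionMove_holds`: `: GenExpansionMove`. -/
theorem genExpansionMove_holds : GenExpansionMove := fun p j N ha hint => p.J_expansion j N ha hint


/-! ## From the generalized cone to the generalized locus, and the conditional BALANCED DECOMPOSITION

`locusRep_of_inNgen`: every admissible convergent integrable point of `N^gen` is a nonnegative-integer combination of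
such points on `L^gen` with the same `a₀` and the same `e` (three composed binomial moves; any `a₀ ∈ ℤ`, any `e`).
`balancedDecompositionIntegrable_of`: `EulerInvariance → ReversalInvariance → BalancedDecompositionIntegrable` — the whole chain of FAMILY
17d(⇐) is formal except for the two change-of-variables identities. -/

namespace GenPoint

/-- `shift_T_zero`: `(p : GenPoint) (i N : ℕ) : (p.shift 0 i N).T = ![p.T 0 + N, p.T 1, p.T 2, p.T 3]`. -/
theorem shift_T_zero (p : GenPoint) (i N : ℕ) : (p.shift 0 i N).T = ![p.T 0 + N, p.T 1, p.T 2, p.T 3] := by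
  funext k
  fin_cases k
  all_goals simp [T, shift_a, shift_b]
  all_goals ring

/-- `shift_T_one`: `(p : GenPoint) (i N : ℕ) : (p.shift 1 i N).T = ![p.T 0 + i, p.T 1 + N, p.T 2, p.T 3]`. -/
theorem shift_T_one (p : GenPoint) (i N : ℕ) : (p.shift 1 i N).T = ![p.T 0 + i, p.T 1 + N, p.T 2, p.T 3] := by
  funext k
  fin_cases k <;> simp [T, shift_a, shift_b] <;> ring

/-- `shift_T_two`: `(p : GenPoint) (i N : ℕ) : (p.shift 2 i N).T = ![p.T 0, p.T 1 + i, p.T 2 + N, p.T 3]`. -/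
theorem shift_T_two (p : GenPoint) (i N : ℕ) : (p.shift 2 i N).T = ![p.T 0, p.T 1 + i, p.T 2 + N, p.T 3] := by
  funext k
  fin_cases k <;> simp [T, shift_a, shift_b] <;> ring

/-- `shift_converges`: `(p : GenPoint) (j : Fin 5) (i N : ℕ) (hi : i ≤ N) (h : p.Converges) : (p.shift j i N).Converges`. -/
theorem shift_converges (p : GenPoint) (j : Fin 5) (i N : ℕ) (hi : i ≤ N) (h : p.Converges) :
    (p.shift j i N).Converges := by
  simp only [Converges, GenPoint.c, shift_a₀, shift_e] at h ⊢
  fin_cases j <;> simp [shift_a, shift_b] <;> omega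

/-- `shift_raw`: `(p : GenPoint) (j : Fin 5) (i N : ℕ) (h : p.Raw) : (p.shift j i N).Raw`. -/
theorem shift_raw (p : GenPoint) (j : Fin 5) (i N : ℕ) (h : p.Raw) : (p.shift j i N).Raw := h

/-- `psi1_admissible`: `(p : GenPoint) (ha : p.Admissible) (h1 : p.c 0 + p.a 1 > p.a₀) : p.psi1.Admissible`. -/
theorem psi1_admissible (p : GenPoint) (ha : p.Admissible) (h1 : p.c 0 + p.a 1 > p.a₀) : p.psi1.Admissible := by
  intro k
  have h0 := ha 0; have ha1 := ha 1; have h2 := ha 2; have h3 := ha 3; have h4 := ha 4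
  simp only [GenPoint.c] at h1
  fin_cases k <;> simp [psi1, GenPoint.c] <;> omega

/-- `psi1_converges`: `(p : GenPoint) (ha : p.Admissible) (h : p.Converges) : p.psi1.Converges`. -/
theorem psi1_converges (p : GenPoint) (ha : p.Admissible) (h : p.Converges) : p.psi1.Converges := by
  have h0 := ha 0; have h1 := ha 1; have h2 := ha 2; have h3 := ha 3; have h4 := ha 4
  simp only [Converges, psi1, GenPoint.c, Fin.isValue] at h ⊢
  simp
  omega

/-- `rev_admissible`: `(p : GenPoint) (ha : p.Admissible) (h1 : p.c 0 + p.a 1 > p.a₀) : p.rev.Admissible`. -/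
theorem rev_admissible (p : GenPoint) (ha : p.Admissible) (h1 : p.c 0 + p.a 1 > p.a₀) : p.rev.Admissible := by
  intro k
  have h0 := ha 0; have ha1 := ha 1; have h2 := ha 2; have h3 := ha 3; have h4 := ha 4
  simp only [GenPoint.c] at h1
  fin_cases k <;> simp [GenPoint.c] <;> omega

/-- `rev_converges`: `(p : GenPoint) (ha : p.Admissible) (h : p.Converges) : p.rev.Converges`. -/
theorem rev_converges (p : GenPoint) (ha : p.Admissible) (h : p.Converges) : p.rev.Converges := by
  have h0 := ha 0; have h1 := ha 1; have h2 := ha 2; have h3 := ha 3; have h4 := ha 4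
  simp only [Converges, GenPoint.c, Fin.isValue] at h ⊢
  simp [GenPoint.c]
  omega

/-- `q.J` is a nonnegative-integer combination of values of admissible convergent integrable points ON `L^gen` with
the same `a₀` and the same `e`. -/
def LocusRep (q : GenPoint) : Prop :=
  ∃ (n : ℕ) (m : Fin n → ℕ) (r : Fin n → GenPoint),
    (∀ t, (r t).OnLgen ∧ (r t).Admissible ∧ (r t).Converges ∧ (r t).Integrable ∧ (r t).a₀ = q.a₀ ∧ (r t).e = q.e) ∧
    q.J = ∑ t, (m t : ℝ) * (r t).J

/-- `locusRep_single`: `(q : GenPoint) (h1 : q.OnLgen) (h2 : q.Admissible) (h3 : q.Converges) (h4 : q.Integrable) : q.LocusRep`. -/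
theorem locusRep_single (q : GenPoint) (h1 : q.OnLgen) (h2 : q.Admissible) (h3 : q.Converges) (h4 : q.Integrable) :
    q.LocusRep :=
  ⟨1, fun _ => 1, fun _ => q, fun _ => ⟨h1, h2, h3, h4, rfl, rfl⟩, by simp⟩

/-- Two-level representations flatten (concatenate the finite families). -/
theorem combine {P : GenPoint → Prop} {n : ℕ} (m : Fin n → ℕ) (r : Fin n → GenPoint)
    (h : ∀ t, ∃ (n' : ℕ) (m' : Fin n' → ℕ) (s : Fin n' → GenPoint),
      (∀ u, P (s u)) ∧ (r t).J = ∑ u, (m' u : ℝ) * (s u).J) :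
    ∃ (n' : ℕ) (m' : Fin n' → ℕ) (s : Fin n' → GenPoint),
      (∀ u, P (s u)) ∧ (∑ t, (m t : ℝ) * (r t).J) = ∑ u, (m' u : ℝ) * (s u).J := by
  classical
  choose n' m' s hP hv using h
  let ι := Σ t : Fin n, Fin (n' t)
  let e := (Fintype.equivFin ι).symm
  refine ⟨Fintype.card ι, fun u => m (e u).1 * m' (e u).1 (e u).2, fun u => s (e u).1 (e u).2,
    fun u => hP (e u).1 (e u).2, ?_⟩
  rw [e.sum_comp (fun q : ι => ((m q.1 * m' q.1 q.2 : ℕ) : ℝ) * (s q.1 q.2).J), Fintype.sum_sigma]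
  refine Fintype.sum_congr _ _ fun t => ?_
  rw [hv t, Finset.mul_sum]
  refine Fintype.sum_congr _ _ fun u => ?_
  push_cast
  ring

/-- A binomial move whose terms all have locus representations gives one for `q`. -/
theorem locusRep_move (q : GenPoint) (j : Fin 5) (N : ℕ) (ha : q.Admissible) (hint : q.Integrable)
    (h : ∀ i ≤ N, (q.shift j i N).LocusRep) : q.LocusRep := by
  have hc := combine
    (P := fun r => r.OnLgen ∧ r.Admissible ∧ r.Converges ∧ r.Integrable ∧ r.a₀ = q.a₀ ∧ r.e = q.e)
    (fun i : Fin (N + 1) => N.choose i) (fun i => q.shift j i N) (fun i => by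
      obtain ⟨n', m', s, hP, hv⟩ := h i (Nat.lt_succ_iff.mp i.isLt)
      exact ⟨n', m', s, hP, hv⟩)
  obtain ⟨n', m', s, hP, hv⟩ := hc
  refine ⟨n', m', s, hP, ?_⟩
  rw [J_expansion q j N ha hint, Finset.sum_range]
  exact hv

/-- `locusRep_stageA`: `(q : GenPoint) (ha : q.Admissible) (hc : q.Converges) (hint : q.Integrable) (h01 : q.T 0 ≤ q.T 1) (h12 : q.…`. -/
theorem locusRep_stageA (q : GenPoint) (ha : q.Admissible) (hc : q.Converges) (hint : q.Integrable)
    (h01 : q.T 0 ≤ q.T 1) (h12 : q.T 1 = q.T 2) (h23 : q.T 2 = q.T 3) : q.LocusRep := by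
  obtain ⟨N, hN⟩ := Int.eq_ofNat_of_zero_le (show (0 : ℤ) ≤ q.T 1 - q.T 0 by omega)
  refine locusRep_move q 0 N ha hint fun i hi => ?_
  refine locusRep_single _ ?_ (shift_admissible q 0 i N ha hi) (shift_converges q 0 i N hi hc)
    (shift_integrable q 0 i N ha hi hint)
  simp only [OnLgen, shift_T_zero]
  simp
  omega

/-- `locusRep_stageB`: `(q : GenPoint) (ha : q.Admissible) (hc : q.Converges) (hint : q.Integrable) (h01 : q.T 0 ≤ q.T 1) (h12 : q.…`. -/
theorem locusRep_stageB (q : GenPoint) (ha : q.Admissible) (hc : q.Converges) (hint : q.Integrable)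
    (h01 : q.T 0 ≤ q.T 1) (h12 : q.T 1 ≤ q.T 2) (h23 : q.T 2 = q.T 3) : q.LocusRep := by
  obtain ⟨N, hN⟩ := Int.eq_ofNat_of_zero_le (show (0 : ℤ) ≤ q.T 2 - q.T 1 by omega)
  refine locusRep_move q 1 N ha hint fun i hi => ?_
  refine locusRep_stageA _ (shift_admissible q 1 i N ha hi) (shift_converges q 1 i N hi hc)
    (shift_integrable q 1 i N ha hi hint) ?_ ?_ ?_
  · simp only [shift_T_one]; simp; omega
  · simp only [shift_T_one]; simp; omega
  · simp only [shift_T_one]; simp; omega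

/-- `locusRep_stageC`: `(q : GenPoint) (ha : q.Admissible) (hc : q.Converges) (hint : q.Integrable) (hN : q.InNgen) : q.LocusRep`. -/
theorem locusRep_stageC (q : GenPoint) (ha : q.Admissible) (hc : q.Converges) (hint : q.Integrable)
    (hN : q.InNgen) : q.LocusRep := by
  obtain ⟨h01, h12, h23⟩ := hN
  obtain ⟨N, hN⟩ := Int.eq_ofNat_of_zero_le (show (0 : ℤ) ≤ q.T 3 - q.T 2 by omega)
  refine locusRep_move q 2 N ha hint fun i hi => ?_
  refine locusRep_stageB _ (shift_admissible q 2 i N ha hi) (shift_converges q 2 i N hi hc)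
    (shift_integrable q 2 i N ha hi hint) ?_ ?_ ?_
  · simp only [shift_T_two]; simp; omega
  · simp only [shift_T_two]; simp; omega
  · simp only [shift_T_two]; simp; omega

/-- GENERALIZED CONE THEOREM (proved): every admissible convergent integrable point of `N^gen` is a nonnegative-integer
combination of admissible convergent integrable points of `L^gen` with the same `a₀` and `e`. -/
theorem locusRep_of_inNgen (q : GenPoint) (ha : q.Admissible) (hc : q.Converges) (hint : q.Integrable)
    (hN : q.InNgen) : q.LocusRep :=
  locusRep_stageC q ha hc hint hN

end GenPoint

open GenPoint in
/-- **BALANCED DECOMPOSITION, conditionally** (FAMILY 17d(⇐) steps (1)–(5) formalised): given the two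
change-of-variables identities `EulerInvariance` (ψ₁) and `ReversalInvariance` (rev), every balanced admissible convergent
integrable point is a nonnegative-integer combination of RAW very-well-poised-locus points. -/
theorem balancedDecompositionIntegrable_of (hE : EulerInvariance) (hR : ReversalInvariance) : BalancedDecompositionIntegrable := by
  intro p ha hconv hint hbal
  have horbit := (balanced_iff_orbit p ha).mp hbal
  have h1p : p.c 0 + p.a 1 > p.a₀ := hconv.1
  obtain ⟨q, hqN, hqE, hqa, hqc, hqi, hJ⟩ : ∃ q : GenPoint,
      q.InNgen ∧ q.Eneg ∧ q.Admissible ∧ q.Converges ∧ q.Integrable ∧ p.J = q.J := by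
    rcases horbit with ⟨hN, hEn⟩ | ⟨hN, hEn⟩ | ⟨hN, hEn⟩ | ⟨hN, hEn⟩
    · exact ⟨p, hN, hEn, ha, hconv, hint, rfl⟩
    · exact ⟨p.psi1, hN, hEn, psi1_admissible p ha h1p, psi1_converges p ha hconv, (hE p).2.mp hint, (hE p).1⟩
    · exact ⟨p.sigma, hN, hEn, sigma_admissible p ha, sigma_converges p ha hconv, p.integrable_sigma_iff.mp hint,
        p.J_sigma⟩
    · exact ⟨p.sigma.psi1, hN, hEn, psi1_admissible _ (sigma_admissible p ha) (sigma_converges p ha hconv).1,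
        psi1_converges _ (sigma_admissible p ha) (sigma_converges p ha hconv),
        (hE p.sigma).2.mp (p.integrable_sigma_iff.mp hint), p.J_sigma.trans (hE p.sigma).1⟩
  obtain ⟨n, m, r, hr, hqJ⟩ := locusRep_of_inNgen q hqa hqc hqi hqN
  have hrev : ∀ t, (r t).rev.Raw ∧ (r t).rev.InNgen ∧ (r t).rev.Admissible ∧ (r t).rev.Converges ∧
      (r t).rev.Integrable ∧ (r t).J = (r t).rev.J := by
    intro t
    obtain ⟨hL, hA, hC, hI, _, he⟩ := hr t
    have hEn : (r t).Eneg := by simp only [Eneg, he]; exact hqE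
    exact ⟨(rev_raw_iff _).mpr hL, (rev_inNgen_iff _).mpr hEn, rev_admissible _ hA hC.1, rev_converges _ hA hC,
      (hR _).2.mp hI, (hR _).1⟩
  have hfin : ∀ t, ∃ (n' : ℕ) (m' : Fin n' → ℕ) (s : Fin n' → GenPoint),
      (∀ u, (s u).Raw ∧ (s u).OnLgen ∧ (s u).Admissible ∧ (s u).Integrable) ∧
      (r t).J = ∑ u, (m' u : ℝ) * (s u).J := by
    intro t
    obtain ⟨hRaw, hN', hA', hC', hI', hJ'⟩ := hrev t
    obtain ⟨n', m', s, hs, hJs⟩ := locusRep_of_inNgen _ hA' hC' hI' hN'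
    refine ⟨n', m', s, fun u => ?_, hJ'.trans hJs⟩
    obtain ⟨hs1, hs2, _, hs4, _, hs6⟩ := hs u
    refine ⟨?_, hs1, hs2, hs4⟩
    simp only [Raw, hs6]
    exact hRaw
  obtain ⟨n', m', s, hs, hv⟩ := combine (P := fun w => w.Raw ∧ w.OnLgen ∧ w.Admissible ∧ w.Integrable) m r hfin
  exact ⟨n', m', s, hs, by rw [hJ, hqJ]; exact hv⟩

end Summit.KontsevichZagierPeriods.Zeta5Search.SorokinCensus
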